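import Summits.QuantumFields.YangMills.Theorems.FemtoTransferGapLevels
import HarnessLib

/-!
# Route `LuscherReduction`, item `DressedRitz` (stmt-QuantumFields-20205), line «polyakovlift» r7, stub S-PSCAL″ — NEGATIVE LEMMA (crux disprover
# ym-cdisprove-20205-1 g8, certifying the interface finding of seat ym-20205-polyakovlift-w1a g1, 2026-08-27T20:55:27Z):
# the SINGLE-FLOOR cluster-gap hypothesis of `PScal.dressed_clauses_of_concentration` (p566328) is UNSATISFIABLE across two windows

The core theorem of the S-PSCAL″ assembly (`…PolyakovLiftPScalingCore`, p566328) takes ONE floor `lamlow` below EVERY concentration window,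
`hlow : ∀ i k, lo i ≤ k → k < hi i → lamlow ≤ λ_k`, together with the gap hypothesis `hgapτ : ∀ i, λ_{hi i} ≤ e^{−τ}·lamlow`.  For antitone levels,
`0 < lamlow` and `0 < τ`, these are JOINTLY UNSATISFIABLE as soon as some window `l` is non-empty and starts at or above the end of another window `i`
(`hi i ≤ lo l < hi l`): `lamlow ≤ λ_{lo l} ≤ λ_{hi i} ≤ e^{−τ}·lamlow < lamlow`.  Hence p566328 can serve only families whose windows all lie in ONE
𝔥-cluster (in the S-PSCAL″ assembly: `k` not exceeding the first excited multiplet); the tree's repair is `PScal.dressed_clauses_of_concentration'`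
(`…PScalingCoreGap`, per-vector gap `λ_{hi i} ≤ e^{−τ}·λ_{i+1}`).  Recorded here as negative knowledge for the crux item (load-bearing-hypothesis
analysis of the pscaling assembly; `Cruxes/DressedRitz/Disproof.lean` §12 (G8-d)).  ★ `single_floor_gap_unsat` (abstract levels),
`levelValue_single_floor_gap_unsat` (the min–max levels of the zero-flux transfer operator, the literal hypotheses of p566328 with `τ > 0`),
whose antitonicity hypothesis is the tree's `KTRCalibration.levelValue_antitone hβ` for `0 ≤ β` (not imported here: that module sits in the route's cone).

HONEST FRAMING: three lines of order arithmetic about the hypotheses of one helper of ONE stub of ONE conditional crux on the femto rung R2b1; no stub is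
closed or refuted; nothing here bears on infinite volume, the continuum limit or the Clay gap.
References: Reed–Simon IV, Thm. XIII.1 (min–max levels are antitone) [cite: ReedSimonIV1978, Thm. XIII.1]; M. Lüscher, NPB 219 (1983) 233 [cite: Luscher1983, §3].
-/

set_option autoImplicit false

noncomputable section

namespace Summit.QuantumFields.YangMills.Theorems.FemtoTransferGap.PolyakovLift.Negative

open Summit.QuantumFields.YangMills.Theorems.FemtoTransferGap

/-- ★ **Single-floor gap hypotheses are unsatisfiable across two windows.**  Antitone levels `lam`, a floor `0 < lamlow` below every window
(`hlow`) and the gap hypothesis `lam (hi i) ≤ e^{−τ}·lamlow` (`hgapτ`, `τ > 0`) cannot hold together once a non-empty window `l` starts at or above the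
end of a window `i`. [cite: ReedSimonIV1978, Thm. XIII.1] -/
theorem single_floor_gap_unsat {kk : ℕ} {lam : ℕ → ℝ} (hanti : Antitone lam) {lo hi : Fin kk → ℕ} {lamlow τ : ℝ}
    (hlow0 : 0 < lamlow) (hτ : 0 < τ) (hlow : ∀ (i : Fin kk) (k : ℕ), lo i ≤ k → k < hi i → lamlow ≤ lam k)
    (hgapτ : ∀ i : Fin kk, lam (hi i) ≤ Real.exp (-τ) * lamlow) {i l : Fin kk} (hsep : hi i ≤ lo l) (hne : lo l < hi l) : False := by
  have h1 : lamlow ≤ lam (lo l) := hlow l (lo l) le_rfl hne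
  have h2 : lam (lo l) ≤ lam (hi i) := hanti hsep
  have h3 : lam (hi i) ≤ Real.exp (-τ) * lamlow := hgapτ i
  have h4 : Real.exp (-τ) < 1 := Real.exp_lt_one_iff.mpr (by linarith)
  nlinarith

/-- The same with a SEPARATE comparison floor `lammin ≤ lamlow` in the gap hypothesis (`λ_{hi i} ≤ e^{−τ}·lammin`): still unsatisfiable — weakening the
right-hand floor does not help; only a PER-VECTOR reference level does (the tree's `…PScalingCoreGap`). [cite: ReedSimonIV1978, Thm. XIII.1] -/
theorem single_floor_gap_unsat_of_le {kk : ℕ} {lam : ℕ → ℝ} (hanti : Antitone lam) {lo hi : Fin kk → ℕ} {lamlow lammin τ : ℝ}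
    (hlow0 : 0 < lamlow) (hmin : lammin ≤ lamlow) (hτ : 0 < τ) (hlow : ∀ (i : Fin kk) (k : ℕ), lo i ≤ k → k < hi i → lamlow ≤ lam k)
    (hgapτ : ∀ i : Fin kk, lam (hi i) ≤ Real.exp (-τ) * lammin) {i l : Fin kk} (hsep : hi i ≤ lo l) (hne : lo l < hi l) : False := by
  refine single_floor_gap_unsat hanti hlow0 hτ hlow (fun j => (hgapτ j).trans ?_) hsep hne
  exact mul_le_mul_of_nonneg_left hmin (Real.exp_pos _).le

/-- ★ **At the literal hypotheses of p566328** (`PScal.dressed_clauses_of_concentration`: levels `λ_k = levelValue su2Rep L β k`, antitone by min–max):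
with `τ > 0`, a single floor `lamlow` serving `hlow` and `hgapτ` forces all windows into one cluster — two windows with `hi i ≤ lo l < hi l` are
contradictory. [cite: ReedSimonIV1978, Thm. XIII.1] -/
theorem levelValue_single_floor_gap_unsat {L : ℕ} [NeZero L] {β : ℝ} {kk : ℕ} {lo hi : Fin kk → ℕ} {lamlow τ : ℝ}
    (hanti : Antitone fun k => levelValue su2Rep L β k) (hlow0 : 0 < lamlow) (hτ : 0 < τ)
    (hlow : ∀ (i : Fin kk) (k : ℕ), lo i ≤ k → k < hi i → lamlow ≤ levelValue su2Rep L β k)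
    (hgapτ : ∀ i : Fin kk, levelValue su2Rep L β (hi i) ≤ Real.exp (-τ) * lamlow) {i l : Fin kk} (hsep : hi i ≤ lo l) (hne : lo l < hi l) :
    False :=
  single_floor_gap_unsat (lam := fun k => levelValue su2Rep L β k) hanti hlow0 hτ hlow hgapτ hsep hne

end Summit.QuantumFields.YangMills.Theorems.FemtoTransferGap.PolyakovLift.Negative

end
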